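import Literature.MathematicalPhysics.QuantumFieldTheory.Balaban1983to89.B1Eq324BenfattoKernelSect5TupleClustersAnchored
import Literature.MathematicalPhysics.QuantumFieldTheory.Balaban1983to89.B1Eq324BenfattoKernelSect5FreeStep
import Literature.MathematicalPhysics.QuantumFieldTheory.Balaban1983to89.B1Eq324BenfattoSect5Psi3Cumulants
import Literature.MathematicalPhysics.QuantumFieldTheory.Balaban1983to89.B1Eq324BenfattoSect5Eq534Cumulants
import HarnessLib

/-!
# `Balaban1983to89.B1Eq324BenfattoKernelSect5FreePerturb` — [BenfattoEtAl1978] §5 pp. 155–159, (5.11)/(5.24)/(5.34) INSIDE THE FREE CUMULANTS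
# UNDER THE CENTRED GAUSSIAN FIELD `𝒩(0,K)` OF A GENERAL KERNEL: a small volume-spread perturbation `Y` of a volume-size Hamiltonian `X` moves
# `Ê^T_{𝒩(0,K)}(·; k)` by at most `2^k·C_k·𝓜̃(Y)·M_u^{k−1}` — the engine (`…Sect5FreePerturb`) AND its two printed instances, the `Ψ₃` removal
# ((5.24), `…Sect5Psi3Cumulants`) and the (5.34) correction / remainder (`…Sect5Eq534Cumulants`), with the covariance decay and the diagonal
# DISPLAYED AS ROWS — PROVED (free side of the class road, `K_ref = K_Λ`; reads row 5 `…KernelSect5TupleClustersAnchored`)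

statement-level skeleton of published theorems with citation tags; proofs where landed; nothing here is a claim about the
Yang–Mills mass gap

WHY THIS MODULE (cell `pub-ymgap`, seat `dag-n08-b` gen 12; node N08 [Balaban1985UV3]; the [BenfattoEtAl1978] source chain behind the (α)-row
`h324c`; FREE SIDE of the class port, `N08-PORT-MAP-CLUSTER-SIDE.md` §3 / `N08-CLASS-TOOLKIT.md` §6 «K_REF OF RECORD»).  `…Sect5FreePerturb` (this seat,
gen 5) proves the identity-plus-Appendix-D engine `|Ê₀^T(X+Y;k+1) − Ê₀^T(X;k+1)| ≤ 2^{k+1}·C_{k+1}·𝓜̃(Y)·M_u^k` under PRINT'S reference field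
`P̂₀ = P0 d α β`, and `…Sect5Psi3Cumulants` / `…Sect5Eq534Cumulants` instantiate it at the `Ψ₃` class ((5.24) *"Ψ₃ can be eliminated … by the
same argument used in eliminating H_J^{(l)}"*), the (5.34) correction class and the (5.34) remainder class (*"making an error … that can be bounded
by (const) e^{−(ϰ/4)b^{3/2}}|Ī|"*).  The engine reads `P̂₀` through exactly two facts: the moment row of the slots (`…Sect5FreeStep.tupleSum_P0_moments`;
kernel edition `…KernelSect5FreeStep.tupleSum_gaussianFieldOfKernel_moments`, p610935) and Appendix D anchored at a `Y`-slot
(`…TupleClustersAnchored.abs_ursellOf_tupleSums_condField_le_anchored_of_uniform` at `Γ = ∅`; kernel edition = row 5 §3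
`…KernelSect5TupleClustersAnchored.abs_ursellOf_tupleSums_kernel_le_anchored_of_uniform`).  On the class road the free-side identification runs
under the CENTRED Gaussian field `gaussianFieldOfKernel K` of the class covariance `K = K_Λ` (design note «K_REF OF RECORD», n08-b g11), so the
four statements are needed with `P̂₀ ↦ gaussianFieldOfKernel K` and the free field's inputs displayed as ROWS: R0 `hK : IsPosSemidefKernel K`,
R1 `hdiag : ∀ y, K y y ≤ c₀`, R2 `hdec : ∀ x y, |K x y| ≤ K₀·exp(−(δ₀·ℓ¹(x,y)))` read at `0 < δ ≤ δ₀` (`K₀ ≥ 1`).  This file is that edition: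
the SAME proofs with the two suppliers replaced by their kernel editions and `max(1, C₀₀) ↦ K₀`; the palette identity
(`…FreeCumulants.cumulantOf_add_sub_eq_of_moments`), the uniform per-anchor mass (`…FreeStepCrossMasses.decayWeightedMass_le`) and the three
class-mass bounds (`…Psi3Cumulants.deltaMass_psi3Class_le`, `…Eq534Cumulants.deltaMass_corrClass_le` / `deltaMass_remainderBar_le`) are
measure-free and consumed BY NAME.

DICTIONARY.  `Ê^T(S;k)` ↦ `cumulantOf (r ↦ ∫ S^r ∂(gaussianFieldOfKernel K)) k`; `X`, `Y` tuple-class sums over `J`; `C_k = 2^{kD}2^{2^{kD}}K₀^{kD}`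
with `K₀` from row R2; `𝓜̃(Y)`, `M_u = A·e^{(δ/2)D²d}·K(δ/(2k), d)·S(ϰ/2 − (δ/2)D²√d)` exactly as in the concrete modules.  The concrete modules are
the instance `K := freeCov d α β` (R2 from `…AppendixC2.freeCov_le_self_mul_pow_l1` at `δ₀ = log((2d+α²)/2d)`, `K₀ = max(1, C₀₀)`).

WHAT IS PROVED (theorems only; no definition, no named fact, no `sorry`; axioms standard).
* §1 ★★ **`abs_cumulantOf_kernel_add_sub_le`** — `|Ê^T_{𝒩(0,K)}(X+Y; k+1) − Ê^T_{𝒩(0,K)}(X; k+1)| ≤ 2^{k+1}·C_{k+1}·𝓜̃(Y)·M_u^k` for any two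
  tuple classes (the engine).
* §2 ★ `abs_cumulantOf_kernel_add_psi3_sub_le` ((5.24): `Y = Σ_□Ψ₃(□)`, `𝓜̃ ≤ |B|·A e^{(δ/2)D²d}e^{−(c/2)v}L^dS(c/2)`), ★
  `abs_cumulantOf_kernel_add_corr_sub_le` ((5.34) correction class, same mass), ★ `abs_cumulantOf_kernel_add_remainder_sub_le` ((5.34)
  remainder class, `𝓜̃ ≤ A e^{(δ/2)D²d}e^{−(c/2)w}|Γ̄₁|S(c/2)`).

HONEST SCOPE / NOT HERE.  (i) Rows DISPLAYED, not discharged (at `K = K_Λ`: J1 `…KernelOfPrecision.kernel_self_le` / `abs_kernel_le_exp`, or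
`…ClassAppendixC.inv_apply_self_pos_le` / `abs_inv_apply_le_exp`, with the class distance compared to `ℓ¹` — the instantiation row's business);
(ii) the `H^{(l)}` instance ((5.11) inside `T₀`, `…Sect5HlCumulants`, seat n08-c) and the assembly (`…IdErrBounds`, `…StepBound`) are NOT here;
(iii) free side of an UNCOMMISSIONED port (plan g81 (II), START-LIST v11 §n08): nothing is chained to it here; no generalised Basic Lemma is stated;
nothing of [Balaban1985UV3] (41)/(47)/(5) is asserted; count-neutral for N08; nothing about d = 4, the continuum, OS axioms, a mass gap or the Clay
problem.
-/

open MeasureTheory ProbabilityTheory Finset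
open scoped BigOperators Nat NNReal

namespace Literature.MathematicalPhysics.QuantumFieldTheory.Balaban1983to89.B1Eq324BenfattoKernelSect5FreePerturb

open _root_.MeasureTheory _root_.ProbabilityTheory
open Literature.Probability.LatticeModels (ursellOf cumulantOf)
open Literature.MathematicalPhysics.QuantumFieldTheory
open Literature.MathematicalPhysics.QuantumFieldTheory.Balaban1983to89.B1Eq324BenfattoLemma
open Literature.MathematicalPhysics.QuantumFieldTheory.Balaban1983to89.B1Eq324BenfattoSect5Boxes
open Literature.MathematicalPhysics.QuantumFieldTheory.Balaban1983to89.B1Eq324BenfattoSect5Eq511 (term tuplesIn)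
open Literature.MathematicalPhysics.QuantumFieldTheory.Balaban1983to89.B1Eq324BenfattoSect5Eq524
open Literature.MathematicalPhysics.QuantumFieldTheory.Balaban1983to89.B1Eq324BenfattoSect5Eq534 (corridorsBar hatTuplesBar)
open Literature.MathematicalPhysics.QuantumFieldTheory.Balaban1983to89.B1Eq324BenfattoSect5FreeCumulants (cumulantOf_add_sub_eq_of_moments)
open Literature.MathematicalPhysics.QuantumFieldTheory.Balaban1983to89.B1Eq324BenfattoKernelSect5FreeStep (tupleSum_gaussianFieldOfKernel_moments)
open Literature.MathematicalPhysics.QuantumFieldTheory.Balaban1983to89.B1Eq324BenfattoKernelSect5TupleClustersAnchored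
  (abs_ursellOf_tupleSums_kernel_le_anchored_of_uniform)
open Literature.MathematicalPhysics.QuantumFieldTheory.Balaban1983to89.B1Eq324BenfattoSect5FreeStepCrossMasses (decayWeightedMass_le)
open Literature.MathematicalPhysics.QuantumFieldTheory.Balaban1983to89.B1Eq324BenfattoSect5Psi3Cumulants (deltaMass_psi3Class_le)
open Literature.MathematicalPhysics.QuantumFieldTheory.Balaban1983to89.B1Eq324BenfattoSect5Eq534Cumulants
  (deltaMass_corrClass_le deltaMass_remainderBar_le)

variable {d : ℕ} {K : B1Eq324BenfattoLemma.Site d → B1Eq324BenfattoLemma.Site d → ℝ}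
variable {s D : ℕ} {κ : ℝ} {a : Coef d} {J : Finset (B1Eq324BenfattoLemma.Site d)} {L w v : ℕ}
  {B : Finset (B1Eq324BenfattoLemma.Site d)}

/-! ## §1  The engine under `𝒩(0,K)` -/

/-- **A SMALL VOLUME-SPREAD PERTURBATION INSIDE A FREE CUMULANT, CENTRED KERNEL FIELD** ((5.11)/(5.24)/(5.34) on the cumulant side): for two tuple
classes `T_X` (any size) and `T_Y` over `J` under `𝒩(0,K)` with rows R0 `hK`, R1 `hdiag`, R2 `hdec` (`K₀ ≥ 1`, `0 < δ ≤ δ₀`), `|A^n_Δ| ≤ A` and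
`ϰ/2 > (δ/2)D²√d`:
`|Ê^T(X+Y; k+1) − Ê^T(X; k+1)| ≤ 2^{k+1}·2^{(k+1)D}2^{2^{(k+1)D}}K₀^{(k+1)D}·𝓜̃(Y)·M_u^k` — the colourings using `Y`
(`…FreeCumulants.cumulantOf_add_sub_eq_of_moments`, moments by `…KernelSect5FreeStep.tupleSum_gaussianFieldOfKernel_moments`), each bounded by
Appendix D anchored at its `Y`-slot (row 5 §3 `…KernelSect5TupleClustersAnchored.abs_ursellOf_tupleSums_kernel_le_anchored_of_uniform`) with the uniform
per-anchor slot mass `M_u` (`…FreeStepCrossMasses.decayWeightedMass_le` at `R_A = {y}`).  The concrete `…FreePerturb.abs_cumulantOf_add_sub_le` is the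
instance `K := freeCov d α β`. [cite: BenfattoEtAl1978, (5.11) p.155, (5.24) p.157, (5.34)–(5.35) p.159] -/
theorem abs_cumulantOf_kernel_add_sub_le (hK : IsPosSemidefKernel K) {c₀ : ℝ≥0} (hdiag : ∀ y, K y y ≤ c₀)
    {K₀ δ₀ : ℝ} (hK₀ : 1 ≤ K₀)
    (hdec : ∀ x y : B1Eq324BenfattoLemma.Site d, |K x y| ≤ K₀ * Real.exp (-(δ₀ * ∑ jj, |((x jj : ℝ) - (y jj : ℝ))|)))
    {δ A : ℝ} (hres : 0 < κ / 2 - δ / 2 * ((D : ℝ) ^ 2 * Real.sqrt d)) (hδ : 0 < δ) (hδle : δ ≤ δ₀)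
    (hA0 : 0 ≤ A) (hA : ∀ (p : ℕ) (Δ : Fin p → B1Eq324BenfattoLemma.Site d) (n : Fin p → ℕ), |a p Δ n| ≤ A)
    (TX TY : (p : ℕ) → Finset (Fin p → J)) (k : ℕ) :
    |cumulantOf (fun r => ∫ z, ((∑ p ∈ Finset.Icc 1 s, ∑ Δ ∈ TX p, ∑ n ∈ admissible p D, term κ a z p Δ n) +
          (∑ p ∈ Finset.Icc 1 s, ∑ Δ ∈ TY p, ∑ n ∈ admissible p D, term κ a z p Δ n)) ^ r ∂(gaussianFieldOfKernel K)) (k + 1) -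
      cumulantOf (fun r => ∫ z, (∑ p ∈ Finset.Icc 1 s, ∑ Δ ∈ TX p, ∑ n ∈ admissible p D, term κ a z p Δ n) ^ r
        ∂(gaussianFieldOfKernel K)) (k + 1)| ≤
      2 ^ (k + 1) * (2 ^ ((k + 1) * D) * 2 ^ 2 ^ ((k + 1) * D) * K₀ ^ ((k + 1) * D)) *
        (∑ p ∈ Finset.Icc 1 s, ∑ Δ ∈ TY p, ∑ n ∈ admissible p D,
          |a p (fun i => (Δ i : B1Eq324BenfattoLemma.Site d)) n| *
            Real.exp (-(κ / 2) * connLength fun i => (Δ i : B1Eq324BenfattoLemma.Site d)) *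
            Real.exp (δ / 2 * ((D : ℝ) ^ 2 * (Real.sqrt d * connLength (fun i => (Δ i : B1Eq324BenfattoLemma.Site d)) + d)))) *
        (A * Real.exp (δ / 2 * ((D : ℝ) ^ 2 * d)) *
          (2 / (1 - Real.exp (-(δ / (2 * ((k + 1 : ℕ) : ℝ)) / Real.sqrt d))) * Real.exp (δ / (2 * ((k + 1 : ℕ) : ℝ)) / Real.sqrt d)) ^ d *
          ∑ p ∈ Finset.Icc 1 s, ((admissible p D).card : ℝ) *
            ((2 / (1 - Real.exp (-((κ / 2 - δ / 2 * ((D : ℝ) ^ 2 * Real.sqrt d)) / (p : ℕ) / Real.sqrt d))) *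
              Real.exp ((κ / 2 - δ / 2 * ((D : ℝ) ^ 2 * Real.sqrt d)) / (p : ℕ) / Real.sqrt d)) ^ d) ^ (p - 1)) ^ k := by
  classical
  haveI : IsProbabilityMeasure (gaussianFieldOfKernel K) := isProbabilityMeasure_gaussianFieldOfKernel hK
  have hK₀0 : 0 ≤ K₀ := zero_le_one.trans hK₀
  -- names
  set C : ℝ := 2 ^ ((k + 1) * D) * 2 ^ 2 ^ ((k + 1) * D) * K₀ ^ ((k + 1) * D) with hC
  set MY : ℝ := ∑ p ∈ Finset.Icc 1 s, ∑ Δ ∈ TY p, ∑ n ∈ admissible p D,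
      |a p (fun i => (Δ i : B1Eq324BenfattoLemma.Site d)) n| *
        Real.exp (-(κ / 2) * connLength fun i => (Δ i : B1Eq324BenfattoLemma.Site d)) *
        Real.exp (δ / 2 * ((D : ℝ) ^ 2 * (Real.sqrt d * connLength (fun i => (Δ i : B1Eq324BenfattoLemma.Site d)) + d))) with hMY
  set Mu : ℝ := A * Real.exp (δ / 2 * ((D : ℝ) ^ 2 * d)) *
      (2 / (1 - Real.exp (-(δ / (2 * ((k + 1 : ℕ) : ℝ)) / Real.sqrt d))) * Real.exp (δ / (2 * ((k + 1 : ℕ) : ℝ)) / Real.sqrt d)) ^ d *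
      ∑ p ∈ Finset.Icc 1 s, ((admissible p D).card : ℝ) *
        ((2 / (1 - Real.exp (-((κ / 2 - δ / 2 * ((D : ℝ) ^ 2 * Real.sqrt d)) / (p : ℕ) / Real.sqrt d))) *
          Real.exp ((κ / 2 - δ / 2 * ((D : ℝ) ^ 2 * Real.sqrt d)) / (p : ℕ) / Real.sqrt d)) ^ d) ^ (p - 1) with hMu
  have hC0 : 0 ≤ C := by positivity
  have hMY0 : 0 ≤ MY := Finset.sum_nonneg fun p _ => Finset.sum_nonneg fun Δ _ => Finset.sum_nonneg fun n _ =>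
    mul_nonneg (mul_nonneg (abs_nonneg _) (Real.exp_pos _).le) (Real.exp_pos _).le
  -- the two-colour palette
  set Tc : Fin 2 → (p : ℕ) → Finset (Fin p → J) := ![TX, TY] with hTc
  set Yf : Fin 2 → (B1Eq324BenfattoLemma.Site d → ℝ) → ℝ := fun c z =>
    ∑ p ∈ Finset.Icc 1 s, ∑ Δ ∈ Tc c p, ∑ n ∈ admissible p D, term κ a z p Δ n with hYf
  have hmo := fun c => tupleSum_gaussianFieldOfKernel_moments (s := s) (D := D) (κ := κ) (a := a) hK (fun y _ => hdiag y) (Tc c)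
  have hid := cumulantOf_add_sub_eq_of_moments (μ := gaussianFieldOfKernel K) (Y := Yf) (fun c => (hmo c).1) k
    (fun c p _ => (hmo c).2 p)
  have e0 : ∀ z, Yf 0 z = ∑ p ∈ Finset.Icc 1 s, ∑ Δ ∈ TX p, ∑ n ∈ admissible p D, term κ a z p Δ n := fun z => by
    simp only [hYf, hTc, Matrix.cons_val_zero]
  have e1 : ∀ z, Yf 1 z = ∑ p ∈ Finset.Icc 1 s, ∑ Δ ∈ TY p, ∑ n ∈ admissible p D, term κ a z p Δ n := fun z => by
    simp only [hYf, hTc, Matrix.cons_val_one, Matrix.cons_val_zero]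
  simp only [e0, e1] at hid
  rw [hid]
  -- each colouring using `Y`: Appendix D anchored at a `Y`-slot
  have hc₂ : 0 < δ / (2 * ((k + 1 : ℕ) : ℝ)) := by positivity
  have hterm : ∀ f ∈ univ.filter (fun f : Fin (k + 1) → Fin 2 => ∃ j, f j = 1),
      |ursellOf (fun P : Finset (Fin (k + 1)) => ∫ z, ∏ j ∈ P, Yf (f j) z ∂(gaussianFieldOfKernel K)) univ| ≤ C * MY * Mu ^ k := by
    intro f hf
    obtain ⟨j₁, hj₁⟩ := (Finset.mem_filter.1 hf).2
    have h := abs_ursellOf_tupleSums_kernel_le_anchored_of_uniform (σ := Fin (k + 1)) (s := s) (D := D) (ϰ := κ) (a := a)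
      hK hdiag (fun j => Tc (f j)) hK₀ hdec hδ.le hδle j₁ (fun _ => Mu)
      (fun j _ y => by
        rw [Fintype.card_fin]
        have hm := decayWeightedMass_le (s := s) (D := D) (ϰ := κ) (a := a) (δ := δ) hres hc₂ hA0 hA (Tc (f j)) {y}
          (fun z => ∑ jj, |((y jj : ℝ) - (z jj : ℝ))|) (fun z _ => ⟨y, Finset.mem_singleton_self y, le_rfl⟩)
        rw [Finset.card_singleton, Nat.cast_one, one_mul] at hm
        exact hm)
    have hprod : ∏ _j ∈ (univ : Finset (Fin (k + 1))).erase j₁, Mu = Mu ^ k := by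
      rw [Finset.prod_const, Finset.card_erase_of_mem (Finset.mem_univ j₁), Finset.card_univ, Fintype.card_fin, Nat.add_sub_cancel]
    rw [Fintype.card_fin, hj₁, hprod] at h
    simp only [hTc, Matrix.cons_val_one, Matrix.cons_val_zero] at h
    exact h
  refine (Finset.abs_sum_le_sum_abs _ _).trans ((Finset.sum_le_sum hterm).trans ?_)
  rw [Finset.sum_const, nsmul_eq_mul]
  have hcard : (((univ.filter (fun f : Fin (k + 1) → Fin 2 => ∃ j, f j = 1)).card : ℕ) : ℝ) ≤ 2 ^ (k + 1) := by
    have h := Finset.card_filter_le (univ : Finset (Fin (k + 1) → Fin 2)) (fun f => ∃ j, f j = 1)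
    rw [Finset.card_univ, Fintype.card_fun, Fintype.card_fin, Fintype.card_fin] at h
    exact_mod_cast h
  have hKnn : ∀ t : ℝ, 0 ≤ t → 0 ≤ 2 / (1 - Real.exp (-t)) := fun t ht =>
    div_nonneg zero_le_two (by rw [sub_nonneg, Real.exp_le_one_iff, neg_nonpos]; exact ht)
  have hMu0 : 0 ≤ Mu :=
    mul_nonneg (mul_nonneg (mul_nonneg hA0 (Real.exp_pos _).le)
      (pow_nonneg (mul_nonneg (hKnn _ (div_nonneg hc₂.le (Real.sqrt_nonneg _))) (Real.exp_pos _).le) _))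
      (Finset.sum_nonneg fun p _ => mul_nonneg (Nat.cast_nonneg _) (pow_nonneg (pow_nonneg (mul_nonneg
        (hKnn _ (div_nonneg (div_nonneg hres.le (Nat.cast_nonneg _)) (Real.sqrt_nonneg _))) (Real.exp_pos _).le) _) _))
  have h0 : 0 ≤ C * MY * Mu ^ k := mul_nonneg (mul_nonneg hC0 hMY0) (pow_nonneg hMu0 _)
  calc _ ≤ 2 ^ (k + 1) * (C * MY * Mu ^ k) := mul_le_mul_of_nonneg_right hcard h0
    _ = _ := by ring

/-! ## §2  The printed instances: `Ψ₃` ((5.24)), the (5.34) correction and the (5.34) remainder -/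

/-- Nonnegativity of the uniform per-anchor mass `M_u`. [folklore] -/
private theorem mu_nonneg {δ A : ℝ} (hres : 0 < κ / 2 - δ / 2 * ((D : ℝ) ^ 2 * Real.sqrt d)) (hδ : 0 < δ) (hA0 : 0 ≤ A) (k : ℕ) :
    0 ≤ A * Real.exp (δ / 2 * ((D : ℝ) ^ 2 * d)) *
      (2 / (1 - Real.exp (-(δ / (2 * ((k + 1 : ℕ) : ℝ)) / Real.sqrt d))) * Real.exp (δ / (2 * ((k + 1 : ℕ) : ℝ)) / Real.sqrt d)) ^ d *
      ∑ p ∈ Finset.Icc 1 s, ((admissible p D).card : ℝ) *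
        ((2 / (1 - Real.exp (-((κ / 2 - δ / 2 * ((D : ℝ) ^ 2 * Real.sqrt d)) / (p : ℕ) / Real.sqrt d))) *
          Real.exp ((κ / 2 - δ / 2 * ((D : ℝ) ^ 2 * Real.sqrt d)) / (p : ℕ) / Real.sqrt d)) ^ d) ^ (p - 1) := by
  have hKnn : ∀ t : ℝ, 0 ≤ t → 0 ≤ 2 / (1 - Real.exp (-t)) := fun t ht =>
    div_nonneg zero_le_two (by rw [sub_nonneg, Real.exp_le_one_iff, neg_nonpos]; exact ht)
  have hc₂ : 0 ≤ δ / (2 * ((k + 1 : ℕ) : ℝ)) := by positivity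
  exact mul_nonneg (mul_nonneg (mul_nonneg hA0 (Real.exp_pos _).le)
      (pow_nonneg (mul_nonneg (hKnn _ (div_nonneg hc₂ (Real.sqrt_nonneg _))) (Real.exp_pos _).le) _))
      (Finset.sum_nonneg fun p _ => mul_nonneg (Nat.cast_nonneg _) (pow_nonneg (pow_nonneg (mul_nonneg
        (hKnn _ (div_nonneg (div_nonneg hres.le (Nat.cast_nonneg _)) (Real.sqrt_nonneg _))) (Real.exp_pos _).le) _) _))

/-- **(5.24) INSIDE THE FREE CUMULANTS, CENTRED KERNEL FIELD**: for ANY tuple class `T_X` and the pavement's `Ψ₃` class `T₃`, under `𝒩(0,K)` with rows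
R0/R1/R2, `|Ê^T(X + Σ_□Ψ₃; k+1) − Ê^T(X; k+1)| ≤ 2^{k+1}·2^{(k+1)D}2^{2^{(k+1)D}}K₀^{(k+1)D}·[|B|·A e^{(δ/2)D²d} e^{−(c/2)v} L^d S(c/2)]·M_u^k`
(`abs_cumulantOf_kernel_add_sub_le` + `…Psi3Cumulants.deltaMass_psi3Class_le`).  The concrete `…Psi3Cumulants.abs_cumulantOf_add_psi3_sub_le` is the
instance `K := freeCov d α β`. [cite: BenfattoEtAl1978, (5.24) p.157, §5 p.159] -/
theorem abs_cumulantOf_kernel_add_psi3_sub_le (hK : IsPosSemidefKernel K) {c₀ : ℝ≥0} (hdiag : ∀ y, K y y ≤ c₀)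
    {K₀ δ₀ : ℝ} (hK₀ : 1 ≤ K₀)
    (hdec : ∀ x y : B1Eq324BenfattoLemma.Site d, |K x y| ≤ K₀ * Real.exp (-(δ₀ * ∑ jj, |((x jj : ℝ) - (y jj : ℝ))|)))
    {δ A : ℝ} (hres : 0 < κ / 2 - δ / 2 * ((D : ℝ) ^ 2 * Real.sqrt d)) (hδ : 0 < δ) (hδle : δ ≤ δ₀)
    (hA0 : 0 ≤ A) (hA : ∀ (p : ℕ) (Δ : Fin p → B1Eq324BenfattoLemma.Site d) (n : Fin p → ℕ), |a p Δ n| ≤ A) (hv : v ≤ 2 * w)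
    (TX : (p : ℕ) → Finset (Fin p → J)) (k : ℕ) :
    |cumulantOf (fun r => ∫ z, ((∑ p ∈ Finset.Icc 1 s, ∑ Δ ∈ TX p, ∑ n ∈ admissible p D, term κ a z p Δ n) +
          (∑ p ∈ Finset.Icc 1 s, ∑ Δ ∈ B.biUnion (fun m =>
            crossT J p (core L w m) (frame2 L w m) \ crossT J p (core L w m) (frame3 L w v m)),
            ∑ n ∈ admissible p D, term κ a z p Δ n)) ^ r ∂(gaussianFieldOfKernel K)) (k + 1) -
      cumulantOf (fun r => ∫ z, (∑ p ∈ Finset.Icc 1 s, ∑ Δ ∈ TX p, ∑ n ∈ admissible p D, term κ a z p Δ n) ^ r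
        ∂(gaussianFieldOfKernel K)) (k + 1)| ≤
      2 ^ (k + 1) * (2 ^ ((k + 1) * D) * 2 ^ 2 ^ ((k + 1) * D) * K₀ ^ ((k + 1) * D)) *
        (B.card * (A * Real.exp (δ / 2 * ((D : ℝ) ^ 2 * d)) * Real.exp (-((κ / 2 - δ / 2 * ((D : ℝ) ^ 2 * Real.sqrt d)) / 2 * v)) *
          (L : ℝ) ^ d * ∑ p ∈ Finset.Icc 1 s, ((admissible p D).card : ℝ) *
            ((2 / (1 - Real.exp (-((κ / 2 - δ / 2 * ((D : ℝ) ^ 2 * Real.sqrt d)) / 2 / (p : ℕ) / Real.sqrt d))) *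
              Real.exp ((κ / 2 - δ / 2 * ((D : ℝ) ^ 2 * Real.sqrt d)) / 2 / (p : ℕ) / Real.sqrt d)) ^ d) ^ (p - 1))) *
        (A * Real.exp (δ / 2 * ((D : ℝ) ^ 2 * d)) *
          (2 / (1 - Real.exp (-(δ / (2 * ((k + 1 : ℕ) : ℝ)) / Real.sqrt d))) * Real.exp (δ / (2 * ((k + 1 : ℕ) : ℝ)) / Real.sqrt d)) ^ d *
          ∑ p ∈ Finset.Icc 1 s, ((admissible p D).card : ℝ) *
            ((2 / (1 - Real.exp (-((κ / 2 - δ / 2 * ((D : ℝ) ^ 2 * Real.sqrt d)) / (p : ℕ) / Real.sqrt d))) *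
              Real.exp ((κ / 2 - δ / 2 * ((D : ℝ) ^ 2 * Real.sqrt d)) / (p : ℕ) / Real.sqrt d)) ^ d) ^ (p - 1)) ^ k := by
  refine (abs_cumulantOf_kernel_add_sub_le hK hdiag hK₀ hdec hres hδ hδle hA0 hA TX _ k).trans ?_
  have hC0 : 0 ≤ 2 ^ (k + 1) * (2 ^ ((k + 1) * D) * 2 ^ 2 ^ ((k + 1) * D) * K₀ ^ ((k + 1) * D)) := by
    have : 0 ≤ K₀ := zero_le_one.trans hK₀
    positivity
  exact mul_le_mul_of_nonneg_right (mul_le_mul_of_nonneg_left (deltaMass_psi3Class_le hres hA0 hA hv) hC0)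
    (pow_nonneg (mu_nonneg hres hδ hA0 k) _)

/-- **THE (5.34) CORRECTION INSIDE THE FREE CUMULANTS, CENTRED KERNEL FIELD**: for ANY tuple class `T_X` and the (5.34) correction class, under
`𝒩(0,K)` with rows R0/R1/R2, the same bound as for `Ψ₃` (`abs_cumulantOf_kernel_add_sub_le` + `…Eq534Cumulants.deltaMass_corrClass_le`).  The concrete
`…Eq534Cumulants.abs_cumulantOf_add_corr_sub_le` is the instance `K := freeCov d α β`. [cite: BenfattoEtAl1978, (5.34) p.159] -/
theorem abs_cumulantOf_kernel_add_corr_sub_le (hK : IsPosSemidefKernel K) {c₀ : ℝ≥0} (hdiag : ∀ y, K y y ≤ c₀)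
    {K₀ δ₀ : ℝ} (hK₀ : 1 ≤ K₀)
    (hdec : ∀ x y : B1Eq324BenfattoLemma.Site d, |K x y| ≤ K₀ * Real.exp (-(δ₀ * ∑ jj, |((x jj : ℝ) - (y jj : ℝ))|)))
    {δ A : ℝ} (hres : 0 < κ / 2 - δ / 2 * ((D : ℝ) ^ 2 * Real.sqrt d)) (hδ : 0 < δ) (hδle : δ ≤ δ₀)
    (hA0 : 0 ≤ A) (hA : ∀ (p : ℕ) (Δ : Fin p → B1Eq324BenfattoLemma.Site d) (n : Fin p → ℕ), |a p Δ n| ≤ A) (hv : v ≤ 2 * w)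
    (TX : (p : ℕ) → Finset (Fin p → J)) (k : ℕ) :
    |cumulantOf (fun r => ∫ z, ((∑ p ∈ Finset.Icc 1 s, ∑ Δ ∈ TX p, ∑ n ∈ admissible p D, term κ a z p Δ n) +
          (∑ p ∈ Finset.Icc 1 s, ∑ Δ ∈ B.biUnion (fun m =>
            crossT J p (frame4 L w v m) (frame2 L w m) \ crossT J p (frame4 L w v m) (frame3 L w v m)),
            ∑ n ∈ admissible p D, term κ a z p Δ n)) ^ r ∂(gaussianFieldOfKernel K)) (k + 1) -
      cumulantOf (fun r => ∫ z, (∑ p ∈ Finset.Icc 1 s, ∑ Δ ∈ TX p, ∑ n ∈ admissible p D, term κ a z p Δ n) ^ r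
        ∂(gaussianFieldOfKernel K)) (k + 1)| ≤
      2 ^ (k + 1) * (2 ^ ((k + 1) * D) * 2 ^ 2 ^ ((k + 1) * D) * K₀ ^ ((k + 1) * D)) *
        (B.card * (A * Real.exp (δ / 2 * ((D : ℝ) ^ 2 * d)) * Real.exp (-((κ / 2 - δ / 2 * ((D : ℝ) ^ 2 * Real.sqrt d)) / 2 * v)) *
          (L : ℝ) ^ d * ∑ p ∈ Finset.Icc 1 s, ((admissible p D).card : ℝ) *
            ((2 / (1 - Real.exp (-((κ / 2 - δ / 2 * ((D : ℝ) ^ 2 * Real.sqrt d)) / 2 / (p : ℕ) / Real.sqrt d))) *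
              Real.exp ((κ / 2 - δ / 2 * ((D : ℝ) ^ 2 * Real.sqrt d)) / 2 / (p : ℕ) / Real.sqrt d)) ^ d) ^ (p - 1))) *
        (A * Real.exp (δ / 2 * ((D : ℝ) ^ 2 * d)) *
          (2 / (1 - Real.exp (-(δ / (2 * ((k + 1 : ℕ) : ℝ)) / Real.sqrt d))) * Real.exp (δ / (2 * ((k + 1 : ℕ) : ℝ)) / Real.sqrt d)) ^ d *
          ∑ p ∈ Finset.Icc 1 s, ((admissible p D).card : ℝ) *
            ((2 / (1 - Real.exp (-((κ / 2 - δ / 2 * ((D : ℝ) ^ 2 * Real.sqrt d)) / (p : ℕ) / Real.sqrt d))) *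
              Real.exp ((κ / 2 - δ / 2 * ((D : ℝ) ^ 2 * Real.sqrt d)) / (p : ℕ) / Real.sqrt d)) ^ d) ^ (p - 1)) ^ k := by
  refine (abs_cumulantOf_kernel_add_sub_le hK hdiag hK₀ hdec hres hδ hδle hA0 hA TX _ k).trans ?_
  have hC0 : 0 ≤ 2 ^ (k + 1) * (2 ^ ((k + 1) * D) * 2 ^ 2 ^ ((k + 1) * D) * K₀ ^ ((k + 1) * D)) := by
    have : 0 ≤ K₀ := zero_le_one.trans hK₀
    positivity
  exact mul_le_mul_of_nonneg_right (mul_le_mul_of_nonneg_left (deltaMass_corrClass_le hres hA0 hA hv) hC0)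
    (pow_nonneg (mu_nonneg hres hδ hA0 k) _)

/-- **THE (5.34) REMAINDER INSIDE THE FREE CUMULANTS, CENTRED KERNEL FIELD**: for ANY tuple class `T_X` and the (5.34) remainder class
(`Γ̄₁`-tuples not accounted by `H_{Γ₁}` and the boxes, `d(Δ) ≥ w`), under `𝒩(0,K)` with rows R0/R1/R2,
`|Ê^T(X + rem; k+1) − Ê^T(X; k+1)| ≤ 2^{k+1}·2^{(k+1)D}2^{2^{(k+1)D}}K₀^{(k+1)D}·[A e^{(δ/2)D²d} e^{−(c/2)w} |Γ̄₁| S(c/2)]·M_u^k`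
(`abs_cumulantOf_kernel_add_sub_le` + `…Eq534Cumulants.deltaMass_remainderBar_le`).  The concrete `…Eq534Cumulants.abs_cumulantOf_add_remainder_sub_le`
is the instance `K := freeCov d α β`. [cite: BenfattoEtAl1978, (5.34)–(5.35) p.159] -/
theorem abs_cumulantOf_kernel_add_remainder_sub_le (hK : IsPosSemidefKernel K) {c₀ : ℝ≥0} (hdiag : ∀ y, K y y ≤ c₀)
    {K₀ δ₀ : ℝ} (hK₀ : 1 ≤ K₀)
    (hdec : ∀ x y : B1Eq324BenfattoLemma.Site d, |K x y| ≤ K₀ * Real.exp (-(δ₀ * ∑ jj, |((x jj : ℝ) - (y jj : ℝ))|)))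
    (hL : 0 < L) {δ A : ℝ} (hres : 0 < κ / 2 - δ / 2 * ((D : ℝ) ^ 2 * Real.sqrt d)) (hδ : 0 < δ) (hδle : δ ≤ δ₀)
    (hA0 : 0 ≤ A) (hA : ∀ (p : ℕ) (Δ : Fin p → B1Eq324BenfattoLemma.Site d) (n : Fin p → ℕ), |a p Δ n| ≤ A)
    (TX : (p : ℕ) → Finset (Fin p → J)) (k : ℕ) :
    |cumulantOf (fun r => ∫ z, ((∑ p ∈ Finset.Icc 1 s, ∑ Δ ∈ TX p, ∑ n ∈ admissible p D, term κ a z p Δ n) +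
          (∑ p ∈ Finset.Icc 1 s, ∑ Δ ∈ tuplesIn J p (corridorsBar L w v B) \ hatTuplesBar J p L w v B,
            ∑ n ∈ admissible p D, term κ a z p Δ n)) ^ r ∂(gaussianFieldOfKernel K)) (k + 1) -
      cumulantOf (fun r => ∫ z, (∑ p ∈ Finset.Icc 1 s, ∑ Δ ∈ TX p, ∑ n ∈ admissible p D, term κ a z p Δ n) ^ r
        ∂(gaussianFieldOfKernel K)) (k + 1)| ≤
      2 ^ (k + 1) * (2 ^ ((k + 1) * D) * 2 ^ 2 ^ ((k + 1) * D) * K₀ ^ ((k + 1) * D)) *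
        (A * Real.exp (δ / 2 * ((D : ℝ) ^ 2 * d)) * Real.exp (-((κ / 2 - δ / 2 * ((D : ℝ) ^ 2 * Real.sqrt d)) / 2 * w)) *
          (corridorsBar L w v B).card * ∑ p ∈ Finset.Icc 1 s, ((admissible p D).card : ℝ) *
            ((2 / (1 - Real.exp (-((κ / 2 - δ / 2 * ((D : ℝ) ^ 2 * Real.sqrt d)) / 2 / (p : ℕ) / Real.sqrt d))) *
              Real.exp ((κ / 2 - δ / 2 * ((D : ℝ) ^ 2 * Real.sqrt d)) / 2 / (p : ℕ) / Real.sqrt d)) ^ d) ^ (p - 1)) *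
        (A * Real.exp (δ / 2 * ((D : ℝ) ^ 2 * d)) *
          (2 / (1 - Real.exp (-(δ / (2 * ((k + 1 : ℕ) : ℝ)) / Real.sqrt d))) * Real.exp (δ / (2 * ((k + 1 : ℕ) : ℝ)) / Real.sqrt d)) ^ d *
          ∑ p ∈ Finset.Icc 1 s, ((admissible p D).card : ℝ) *
            ((2 / (1 - Real.exp (-((κ / 2 - δ / 2 * ((D : ℝ) ^ 2 * Real.sqrt d)) / (p : ℕ) / Real.sqrt d))) *
              Real.exp ((κ / 2 - δ / 2 * ((D : ℝ) ^ 2 * Real.sqrt d)) / (p : ℕ) / Real.sqrt d)) ^ d) ^ (p - 1)) ^ k := by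
  refine (abs_cumulantOf_kernel_add_sub_le hK hdiag hK₀ hdec hres hδ hδle hA0 hA TX _ k).trans ?_
  have hC0 : 0 ≤ 2 ^ (k + 1) * (2 ^ ((k + 1) * D) * 2 ^ 2 ^ ((k + 1) * D) * K₀ ^ ((k + 1) * D)) := by
    have : 0 ≤ K₀ := zero_le_one.trans hK₀
    positivity
  exact mul_le_mul_of_nonneg_right (mul_le_mul_of_nonneg_left (deltaMass_remainderBar_le hL hres hA0 hA) hC0)
    (pow_nonneg (mu_nonneg hres hδ hA0 k) _)

end Literature.MathematicalPhysics.QuantumFieldTheory.Balaban1983to89.B1Eq324BenfattoKernelSect5FreePerturb
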